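/-
Copyright (c) 2026 the pub-hodgecm-mathlib formalisation cell (harness21).  Prover seat hodgecm-mathlib-LH4-p09 (g8), req620 Track A «(D-RAM) FOUR-FRAME» squad
(heir LEAD F0P3a-plan (g20) T19-24 «STAGE-1b PRE-SCOPING BY IDLE HANDS: ALLOWED AS SCOPING»; dealer LH4-plan (g12)).  2026-09-04.
-/
import Summits.HodgeConjecture.HodgeConjecture.Theorems.F0P3cDyRamDiagonalKappaOrbitCountMult   -- ★ (Oκ2c)-MULT (LH4-p05 (g3)): signed engine ★ `…DiagonalKappaOrbitCount`, (Oκ2b)-MULT `…_of_mem_normalisedStableLattices`; brings `signChar`, `kappaCount`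
import Summits.HodgeConjecture.HodgeConjecture.Theorems.F0P3cDyRamLevelSumSignClasses           -- ★ p858861 (this seat): κ-side eightfold symmetrisation with a label; brings ★ p858820 (labelled re-indexing, `finsum_mem_sep_eq_finsum_mem_ite`), ★ p858764
import HarnessLib

/-!
# Crux `H413`, line LH4 «(D-RAM) FOUR-FRAME» road — STAGE-1b SCOPING BRICK «(L-model-K)»: THE κ-SIDE STAGE A ((Oκ2a) + (Oκ2c)-MULT) WITH A DIAGONAL-INVARIANT LABEL,
# and the composite: the κ-WEIGHTED four-frame LEVELS census is `4·ω_i·` the labelled κ-Stage-B sum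

Cell `hodgecm-mathlib` (D-0151), FLOOR 0, crux item H413 = `stmt-HodgeConjecture-24833`, route of record `HCCMUnconditional`; squad F0∕P3c∕LH4 (req618∕req620).
THEOREMS ONLY (no `def`, no instance, no notation, no `sorry`, default heartbeats); lane `--supports stmt-HodgeConjecture-24833 --as helper` (count-neutral).
Consumers: the STAGE-1b producers of the κ-laws (K-ABS)∕(K-SGN) at shifted exponents for the level censuses (F0P3a-p01 (g35) SIGSHEET-1b draft (F2)∕(F3): `κ_i(sq_{m*}) =
ε_i·4(q^{k−c} − q^{k−B_i})⁺∕(q−1)`, …).  ★ p858861 gives the κ-weighted eightfold symmetrisation of the four-frame levels census (`2·Σ_b κ_i(b)·levels(Γ_b) = Σ_s χ_i(s)·C_levels(s)`);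
this file is the κ-twin of ★ p858820: the SIGNED orbit count of ★ `F0P3cDyRamDiagonalKappaOrbitCount{,Mult}` with a label riding along, and the composite.

THE MATHEMATICS ([Kottwitz1986BaseChangeUnits, §1]; [Rogawski1990, §4.9–§4.10]; [LanglandsShelstad1987, §3]).  `Q` a label of lattices with `Q(diag(z)·M) ↔ Q(M)` for all
`z ∈ (K^×)³`, `χ⁰_i(e) = signChar i e` the sign table of the κ-engine, `C_Q(e) := #{M : type tv for diag(d_e), T·M = M, Q M}`.  (1) Class by class the labelled re-indexing of ★ p858820
(`ncard_fixed_vertices_sep_eq_ncard_normalised_pairs`) regroups `Σ_e χ⁰_i(e)·C_Q(e)` as `Σᶠ_{M₀ ∈ 𝓛₀(T)} F_Q(M₀)`, `F_Q(M) := Σ_e χ⁰_i(e)·#{a : Q M ∧ diag(ϖ^{a})·M type tv for diag(d_e)}`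
(§1).  (2) The label is constant on unit-torus orbits, so `F_Q = F` on the `Q`-orbits and `0` on the others; ★ (Oκ2b)-MULT (`Σ_e χ⁰_i(e)·(Σᶠ_{𝒯·M₀} #fibre_e)·[𝒰 : S_F] = 8·[𝒯 : S̃]·
kappaCount_i(M₀)`) is therefore the hypothesis of the ★ SIGNED engine `finsum_mem_eq_eight_mul_finsum_mul_stabiliserWeight` for `F_Q` with multiplicity `[Q]·kappaCount_i`, whence (§2)
`↑(Σ_e χ⁰_i(e)·C_Q(e)) = 8·Σᶠ_{M₀ ∈ 𝓛₀(T), Q M₀} kappaCount σ ϖ tv i M₀ · stabiliserWeight σ M₀`.  (3) With ★ p858861 (`χ_i = ω_i·χ⁰_i`, `ω_i = (ω(−1), ω(−1), 1)_i`):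
`Σ_b κ_i(b)·#{M : type t Φ₃, Γ_b M = M, (Γ_b−1)M ⊆ ϖ^aM, (Γ_b−1)²M ⊆ ϖ^{c′}M} = 4·ω_i·Σᶠ_{M₀ ∈ 𝓛₀(diag(α,β,1)), levels(M₀)} kappaCount σ ϖ t i M₀ · stabiliserWeight σ M₀` (§3).
* §1 `cast_sum_signChar_mul_ncard_fixed_vertices_sep_eq_finsum` — labelled (Oκ2a).
* §2 `cast_sum_signChar_mul_ncard_sep_eq_eight_mul_finsum_kappaCount` — labelled (Oκ2c)-MULT (HEAD, any diagonal-invariant label); the levels instance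
  `cast_sum_signChar_mul_ncard_levels_eq_eight_mul_finsum_kappaCount`.
* §3 `chi_eq_omega_mul_signChar` (the two sign tables), HEAD `sum_kappaChar_mul_levelsCount_eq_four_mul_omega_mul_finsum_kappaCount_mul_stabiliserWeight`.
HONEST LABEL.  Count-neutral (`--supports`); signed orbit bookkeeping over ★ files, nothing printed is asserted; pays NO tier-0 row; the labelled κ-Stage-B tables are NOT here;
the census laws stay PROVER TARGETS; `HC_CM` is proved only modulo the 7 printed citations (2 remaining named inputs: hLiu418 = `stmt-HodgeConjecture-24832`, h413 =
`stmt-HodgeConjecture-24833`) until rung 0 closes.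

## References
* [Kottwitz1986BaseChangeUnits] R. E. Kottwitz, *Base change for unit elements of Hecke algebras*, Compositio Math. 60 (1986), §1 pp. 240–241 (signed lattice counts modulo the
  torus, weighted by stabiliser indices).
* [Rogawski1990] J. D. Rogawski, *Automorphic Representations of Unitary Groups in Three Variables*, Ann. of Math. Stud. 123 (1990), §4.9 Prop. 4.9.1 (a)(b) p. 55, §4.10 p. 58.
* [LanglandsShelstad1987] R. P. Langlands, D. Shelstad, *On the definition of transfer factors*, Math. Ann. 278 (1987), §1.3, §3.
-/

set_option autoImplicit false

noncomputable section

namespace Summit.HodgeConjecture.HodgeConjecture.Cruxes.H413.F0P3cDyRamDiagonalKappaOrbitCountLabelled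

open Literature.NumberTheory.Automorphic Literature.NumberTheory.Automorphic.HermitianLattice
open Literature.NumberTheory.Automorphic.UnitaryLatticeTree Literature.NumberTheory.Automorphic.UnitaryThreeFourFrame
open Summit.HodgeConjecture.HodgeConjecture.Cruxes.H413.F0P3cDyRamDiagonalTorusDefs
open Summit.HodgeConjecture.HodgeConjecture.Cruxes.H413.F0P3cDyRamDiagonalStrataDefs
open Summit.HodgeConjecture.HodgeConjecture.Cruxes.H413.F0P3cDyRamDiagonalPairReindex
open Summit.HodgeConjecture.HodgeConjecture.Cruxes.H413.F0P3cDyRamDiagonalFixedFinite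
open Summit.HodgeConjecture.HodgeConjecture.Cruxes.H413.F0P3cDyRamDiagonalStableLatticesFinite
open Summit.HodgeConjecture.HodgeConjecture.Cruxes.H413.F0P3cDyRamDiagonalOrbitFibreCountHeads
open Summit.HodgeConjecture.HodgeConjecture.Cruxes.H413.F0P3cDyRamDiagonalKappaCountDefs
open Summit.HodgeConjecture.HodgeConjecture.Cruxes.H413.F0P3cDyRamDiagonalKappaOrbitCount
open Summit.HodgeConjecture.HodgeConjecture.Cruxes.H413.F0P3cDyRamDiagonalKappaOrbitCountMult
open Summit.HodgeConjecture.HodgeConjecture.Cruxes.H413.F0P3cDyRamFourFrameCensusDefs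
open Summit.HodgeConjecture.HodgeConjecture.Cruxes.H413.F0P3cDyRamDiagonalOrbitCountLabelled
open Summit.HodgeConjecture.HodgeConjecture.Cruxes.H413.F0P3cDyRamLevelSumSignClasses
open scoped Valued WithZero Matrix MatrixGroups

variable {K : Type} [Field K] [Valued K ℤᵐ⁰]

/-! ## §1  Labelled (Oκ2a): the signed label-cut eight-class sum re-indexed over `𝓛₀(T)` -/

/-- **LABELLED (Oκ2a).**  Finite residue field, valuation-preserving `σ`, uniformiser `ϖ = ↑ϖu`, a unit `c`, a regular unit diagonal `T = diag(s)`, a type `tv`, a slot `i` and a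
label `Q` invariant under diagonal translates: `↑(Σ_e χ⁰_i(e)·#{M : type tv for diag(d_e), T·M = M, Q M}) = Σᶠ_{M₀ ∈ 𝓛₀(T)} Σ_e χ⁰_i(e)·#{a : Q M₀ ∧ diag(ϖu^{a})·M₀ type tv for
diag(d_e)}` in `ℚ` (★ (Oκ2a)'s proof with ★ p858820 `ncard_fixed_vertices_sep_eq_ncard_normalised_pairs` class by class). [cite: Kottwitz1986BaseChangeUnits, §1 pp. 240–241]
[cite: LanglandsShelstad1987, §3] -/
theorem cast_sum_signChar_mul_ncard_fixed_vertices_sep_eq_finsum [Finite 𝓀[K]] {σ : K →+* K}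
    (hvσ : ∀ a, Valued.v (σ a) = Valued.v a) {ϖ : K} (hϖ : Valued.v ϖ = WithZero.exp (-1 : ℤ)) (ϖu : Kˣ) (hϖu : (ϖu : K) = ϖ)
    {c : K} (hcv : Valued.v c = 1) {s : Fin 3 → K} (hs : ∀ i, Valued.v (s i) = 1) (hreg : ∀ i j, i ≠ j → s i ≠ s j)
    (T : GL (Fin 3) K) (hT : (T : Matrix (Fin 3) (Fin 3) K) = Matrix.diagonal s) (tv : ℕ) (i : Fin 3)
    (Q : Submodule 𝒪[K] (Fin 3 → K) → Prop) (hQ : ∀ (z : Fin 3 → Kˣ) (M : Submodule 𝒪[K] (Fin 3 → K)), Q (mapGL (diagGLUnits z) M) ↔ Q M) :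
    (((∑ e : Fin 3 → Bool,
        (![(if e 1 then -1 else 1) * (if e 2 then -1 else 1),
           (if e 0 then -1 else 1) * (if e 2 then -1 else 1),
           (if e 0 then -1 else 1) * (if e 1 then -1 else 1)] : Fin 3 → ℤ) i *
          ({M : Submodule 𝒪[K] (Fin 3 → K) |
            IsVertexLattice σ ϖ (Matrix.diagonal fun j => if e j then c else (1 : K)) tv M ∧ mapGL T M = M ∧ Q M}.ncard : ℤ) : ℤ) : ℚ)) =
      ∑ᶠ M₀ ∈ normalisedStableLattices T, ∑ e : Fin 3 → Bool, (signChar i e : ℚ) *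
        ((({a : Fin 3 → ℤ | Q M₀ ∧ IsVertexLattice σ ϖ (Matrix.diagonal fun j => if e j then c else (1 : K)) tv
            (mapGL (diagGLUnits fun j => ϖu ^ a j) M₀)} : Set _).ncard : ℕ) : ℚ) := by
  classical
  have hd : ∀ (e : Fin 3 → Bool) (j : Fin 3), Valued.v (if e j then c else (1 : K)) = 1 := by
    intro e j; split_ifs
    · exact hcv
    · exact map_one _
  have hs' : ∀ j, Valued.v (s j) ≤ 1 := fun j => (hs j).le
  have hinj : Function.Injective s := fun j j' hjj => by
    by_contra h; exact hreg j j' h hjj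
  have h𝓛 : (normalisedStableLattices T).Finite := finite_setOf_normalised_diagonal_fixed_latt hϖ s hs hreg T hT
  -- the labelled pair sets are finite (subsets of ★ (O2a)'s), class by class, hence so is every fibre
  have hSR : ∀ e : Fin 3 → Bool, {p : Submodule 𝒪[K] (Fin 3 → K) × (Fin 3 → ℤ) | p.1 ∈ normalisedStableLattices T ∧ Q p.1 ∧
      IsVertexLattice σ ϖ (Matrix.diagonal fun j => if e j then c else (1 : K)) tv (mapGL (diagGLUnits fun j => ϖu ^ p.2 j) p.1)}.Finite := fun e =>
    (finite_normalisedPairs_of_finite_fixed_vertices σ hϖ ϖu hϖu _ tv T hT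
      (finite_setOf_isVertexLattice_mapGL_diagonal_eq hvσ hϖ (hd e) s hs' hinj T hT tv)).subset fun p hp => ⟨hp.1, hp.2.2⟩
  have hA : ∀ (e : Fin 3 → Bool), ∀ M₀ ∈ normalisedStableLattices T, ({a : Fin 3 → ℤ | Q M₀ ∧
      IsVertexLattice σ ϖ (Matrix.diagonal fun j => if e j then c else (1 : K)) tv (mapGL (diagGLUnits fun j => ϖu ^ a j) M₀)} : Set _).Finite :=
    fun e M₀ hM₀ => ((hSR e).preimage (Prod.mk_right_injective M₀).injOn).subset fun a ha => ⟨hM₀, ha⟩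
  -- class by class: ★ p858820's labelled bijection, then the fibrewise count over `𝓛₀(T)`
  have h1 : ∀ e : Fin 3 → Bool, ({M : Submodule 𝒪[K] (Fin 3 → K) |
        IsVertexLattice σ ϖ (Matrix.diagonal fun j => if e j then c else (1 : K)) tv M ∧ mapGL T M = M ∧ Q M}.ncard : ℕ) =
      ∑ M₀ ∈ h𝓛.toFinset, ({a : Fin 3 → ℤ | Q M₀ ∧
        IsVertexLattice σ ϖ (Matrix.diagonal fun j => if e j then c else (1 : K)) tv (mapGL (diagGLUnits fun j => ϖu ^ a j) M₀)} : Set _).ncard := fun e => by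
    rw [ncard_fixed_vertices_sep_eq_ncard_normalised_pairs σ hϖ ϖu hϖu _ tv T hT Q hQ, ← finsum_mem_eq_finite_toFinset_sum _ h𝓛]
    exact ncard_setOf_mem_and_mem_eq_finsum_mem h𝓛 (fun M₀ => ({a : Fin 3 → ℤ | Q M₀ ∧
      IsVertexLattice σ ϖ (Matrix.diagonal fun j => if e j then c else (1 : K)) tv (mapGL (diagGLUnits fun j => ϖu ^ a j) M₀)} : Set _)) (hA e)
  rw [finsum_mem_eq_finite_toFinset_sum _ h𝓛, Finset.sum_comm]
  push_cast
  refine Finset.sum_congr rfl fun e _ => ?_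
  rw [h1 e, Nat.cast_sum, Finset.mul_sum]
  rfl

/-! ## §2  Labelled (Oκ2c)-MULT: the signed label-cut eight-class sum in `kappaCount`-weight currency -/

/-- **LABELLED κ-STAGE A — (Oκ2c) WITH MULTIPLICITY AND A DIAGONAL-INVARIANT LABEL.**  For `T = diag(s)` (`s` pairwise-distinct units, finite residue field), an involution `σ`
with `v ∘ σ = v`, a uniformiser `ϖ = ↑ϖu`, a `σ`-fixed NON-NORM unit `c` with the index-two dichotomy, a vertex type `tv`, a slot `i` and a label `Q` with `Q(diag(z)·M) ↔ Q(M)`: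
`↑(Σ_e χ⁰_i(e)·#{M : type tv for diag(d_e), T·M = M, Q M}) = 8 · Σᶠ_{M₀ ∈ 𝓛₀(T), Q M₀} kappaCount σ ϖ tv i M₀ · stabiliserWeight σ M₀` over `ℚ` — §1 + the ★ signed engine fed with
`F_Q` and the multiplicity `[Q]·kappaCount_i` (the label is constant on `𝒯·M₀`, so ★ (Oκ2b)-MULT is the per-orbit hypothesis on the `Q`-orbits and both sides vanish on the others);
`Q ≡ True` is ★ `cast_sum_signChar_mul_ncard_eq_eight_mul_finsum_kappaCount_mult`. [cite: Kottwitz1986BaseChangeUnits, §1 pp. 240–241] [cite: Rogawski1990, §4.9 Prop. 4.9.1 (a) p. 55; §4.10 p. 58] -/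
theorem cast_sum_signChar_mul_ncard_sep_eq_eight_mul_finsum_kappaCount [Finite 𝓀[K]] {σ : K →+* K} (hσ : ∀ x, σ (σ x) = x)
    (hvσ : ∀ a, Valued.v (σ a) = Valued.v a) {ϖ : K} (hϖ : Valued.v ϖ = WithZero.exp (-1 : ℤ)) (ϖu : Kˣ) (hϖu : (ϖu : K) = ϖ)
    {c : K} (hσc : σ c = c) (hcv : Valued.v c = 1) (hc : ¬ ∃ z : K, z * σ z = c)
    (hdich : ∀ x : K, σ x = x → x ≠ 0 → (∃ z : K, z * σ z = x) ∨ ∃ z : K, z * σ z = c * x)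
    {s : Fin 3 → K} (hs : ∀ i, Valued.v (s i) = 1) (hreg : ∀ i j, i ≠ j → s i ≠ s j)
    (T : GL (Fin 3) K) (hT : (T : Matrix (Fin 3) (Fin 3) K) = Matrix.diagonal s) (tv : ℕ) (i : Fin 3)
    (Q : Submodule 𝒪[K] (Fin 3 → K) → Prop) (hQ : ∀ (z : Fin 3 → Kˣ) (M : Submodule 𝒪[K] (Fin 3 → K)), Q (mapGL (diagGLUnits z) M) ↔ Q M) :
    (((∑ e : Fin 3 → Bool,
        (![(if e 1 then -1 else 1) * (if e 2 then -1 else 1),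
           (if e 0 then -1 else 1) * (if e 2 then -1 else 1),
           (if e 0 then -1 else 1) * (if e 1 then -1 else 1)] : Fin 3 → ℤ) i *
          ({M : Submodule 𝒪[K] (Fin 3 → K) |
            IsVertexLattice σ ϖ (Matrix.diagonal fun j => if e j then c else (1 : K)) tv M ∧ mapGL T M = M ∧ Q M}.ncard : ℤ) : ℤ) : ℚ)) =
      8 * ∑ᶠ M₀ ∈ {M | M ∈ normalisedStableLattices T ∧ Q M}, (kappaCount σ ϖ tv i M₀ : ℚ) * stabiliserWeight σ M₀ := by
  classical
  have h𝓛 : (normalisedStableLattices T).Finite := finite_setOf_normalised_diagonal_fixed_latt hϖ s hs hreg T hT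
  rw [cast_sum_signChar_mul_ncard_fixed_vertices_sep_eq_finsum hvσ hϖ ϖu hϖu hcv hs hreg T hT tv i Q hQ]
  have key := finsum_mem_eq_eight_mul_finsum_mul_stabiliserWeight hϖ hs hreg T hT σ
    (fun M => ∑ e : Fin 3 → Bool, (signChar i e : ℚ) *
      ((({a : Fin 3 → ℤ | Q M ∧ IsVertexLattice σ ϖ (Matrix.diagonal fun j => if e j then c else (1 : K)) tv
          (mapGL (diagGLUnits fun j => ϖu ^ a j) M)} : Set _).ncard : ℕ) : ℚ))
    (fun M₀ => if Q M₀ then (kappaCount σ ϖ tv i M₀ : ℚ) else 0) fun M₀ hM₀ => ?_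
  · rw [key, finsum_mem_sep_eq_finsum_mem_ite h𝓛 Q]
    congr 1
    refine finsum_mem_congr rfl fun M₀ _ => ?_
    split_ifs <;> simp
  -- the per-orbit hypothesis: the label is constant on the unit-torus orbit of `M₀`
  · have hfinO := finite_unitTorus_orbit_of_mem_normalisedStableLattices hϖ hs hreg T hT hM₀
    by_cases hQ₀ : Q M₀
    · rw [if_pos hQ₀]
      -- on a `Q`-orbit the labelled fibres are the unlabelled ones
      have hF : ∀ M ∈ {M : Submodule 𝒪[K] (Fin 3 → K) | ∃ u ∈ unitTorus K 3, M = mapGL (diagGLUnits u) M₀},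
          (∑ e : Fin 3 → Bool, (signChar i e : ℚ) *
            ((({a : Fin 3 → ℤ | Q M ∧ IsVertexLattice σ ϖ (Matrix.diagonal fun j => if e j then c else (1 : K)) tv
                (mapGL (diagGLUnits fun j => ϖu ^ a j) M)} : Set _).ncard : ℕ) : ℚ)) =
          ∑ e : Fin 3 → Bool, (signChar i e : ℚ) *
            ((({a : Fin 3 → ℤ | IsVertexLattice σ ϖ (Matrix.diagonal fun j => if e j then c else (1 : K)) tv
                (mapGL (diagGLUnits fun j => ϖu ^ a j) M)} : Set _).ncard : ℕ) : ℚ) := by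
        rintro M ⟨u, -, rfl⟩
        have hQM : Q (mapGL (diagGLUnits u) M₀) := (hQ u M₀).2 hQ₀
        refine Finset.sum_congr rfl fun e _ => ?_
        congr 3
        ext a
        simp only [Set.mem_setOf_eq, hQM, true_and]
      rw [finsum_mem_congr rfl hF]
      -- swap the orbit sum with the class sum, then ★ (Oκ2b)-MULT
      have hswap : (∑ᶠ M ∈ {M : Submodule 𝒪[K] (Fin 3 → K) | ∃ u ∈ unitTorus K 3, M = mapGL (diagGLUnits u) M₀},
          ∑ e : Fin 3 → Bool, (signChar i e : ℚ) *
            ((({a : Fin 3 → ℤ | IsVertexLattice σ ϖ (Matrix.diagonal fun j => if e j then c else (1 : K)) tv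
                (mapGL (diagGLUnits fun j => ϖu ^ a j) M)} : Set _).ncard : ℕ) : ℚ)) =
          ∑ e : Fin 3 → Bool, (signChar i e : ℚ) *
            ((∑ᶠ M ∈ {M : Submodule 𝒪[K] (Fin 3 → K) | ∃ u ∈ unitTorus K 3, M = mapGL (diagGLUnits u) M₀},
              ({a : Fin 3 → ℤ | IsVertexLattice σ ϖ (Matrix.diagonal fun j => if e j then c else (1 : K)) tv
                (mapGL (diagGLUnits fun j => ϖu ^ a j) M)} : Set _).ncard : ℕ) : ℚ) := by
        rw [finsum_mem_eq_finite_toFinset_sum _ hfinO, Finset.sum_comm]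
        refine Finset.sum_congr rfl fun e _ => ?_
        rw [finsum_mem_eq_finite_toFinset_sum _ hfinO, Nat.cast_sum, Finset.mul_sum]
      rw [hswap]
      exact sum_signChar_mul_finsum_ncard_fibre_mul_relIndex_eq_mul_kappaCount_of_mem_normalisedStableLattices hσ hvσ hϖ ϖu hϖu hσc hcv hc hdich hs hreg
        T hT hM₀ tv i
    · rw [if_neg hQ₀, mul_zero]
      have hzero : ∀ M ∈ {M : Submodule 𝒪[K] (Fin 3 → K) | ∃ u ∈ unitTorus K 3, M = mapGL (diagGLUnits u) M₀},
          (∑ e : Fin 3 → Bool, (signChar i e : ℚ) *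
            ((({a : Fin 3 → ℤ | Q M ∧ IsVertexLattice σ ϖ (Matrix.diagonal fun j => if e j then c else (1 : K)) tv
                (mapGL (diagGLUnits fun j => ϖu ^ a j) M)} : Set _).ncard : ℕ) : ℚ)) = 0 := by
        rintro M ⟨u, -, rfl⟩
        have hQM : ¬ Q (mapGL (diagGLUnits u) M₀) := fun h => hQ₀ ((hQ u M₀).1 h)
        refine Finset.sum_eq_zero fun e _ => ?_
        have hempty : ({a : Fin 3 → ℤ | Q (mapGL (diagGLUnits u) M₀) ∧
            IsVertexLattice σ ϖ (Matrix.diagonal fun j => if e j then c else (1 : K)) tv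
              (mapGL (diagGLUnits fun j => ϖu ^ a j) (mapGL (diagGLUnits u) M₀))} : Set _) = ∅ :=
          Set.eq_empty_of_forall_notMem fun a ha => hQM ha.1
        rw [hempty, Set.ncard_empty, Nat.cast_zero, mul_zero]
      rw [finsum_mem_congr rfl hzero]
      simp only [finsum_zero, zero_mul]

/-- **THE LEVELS INSTANCE of the labelled κ-Stage A** (`Q M := diag(e₁)·M ⊆ ϖ^a·M ∧ diag(e₂)·M ⊆ ϖ^{c′}·M`, LH4-p06 (g6)'s currency in the model; ★ p858820
`levels_mapGL_diagGLUnits_iff` discharges the invariance). [cite: Kottwitz1986BaseChangeUnits, §1 pp. 240–241] [cite: Rogawski1990, §4.9 Prop. 4.9.1 (a)(b) p. 55] -/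
theorem cast_sum_signChar_mul_ncard_levels_eq_eight_mul_finsum_kappaCount [Finite 𝓀[K]] {σ : K →+* K} (hσ : ∀ x, σ (σ x) = x)
    (hvσ : ∀ a, Valued.v (σ a) = Valued.v a) {ϖ : K} (hϖ : Valued.v ϖ = WithZero.exp (-1 : ℤ)) (ϖu : Kˣ) (hϖu : (ϖu : K) = ϖ)
    {c : K} (hσc : σ c = c) (hcv : Valued.v c = 1) (hc : ¬ ∃ z : K, z * σ z = c)
    (hdich : ∀ x : K, σ x = x → x ≠ 0 → (∃ z : K, z * σ z = x) ∨ ∃ z : K, z * σ z = c * x)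
    {s : Fin 3 → K} (hs : ∀ i, Valued.v (s i) = 1) (hreg : ∀ i j, i ≠ j → s i ≠ s j)
    (T : GL (Fin 3) K) (hT : (T : Matrix (Fin 3) (Fin 3) K) = Matrix.diagonal s) (tv : ℕ) (i : Fin 3) (a c' : ℕ) (e₁ e₂ : Fin 3 → K) :
    (((∑ e : Fin 3 → Bool,
        (![(if e 1 then -1 else 1) * (if e 2 then -1 else 1),
           (if e 0 then -1 else 1) * (if e 2 then -1 else 1),
           (if e 0 then -1 else 1) * (if e 1 then -1 else 1)] : Fin 3 → ℤ) i *
          ({M : Submodule 𝒪[K] (Fin 3 → K) |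
            IsVertexLattice σ ϖ (Matrix.diagonal fun j => if e j then c else (1 : K)) tv M ∧ mapGL T M = M ∧
              (LatticeInLevel ϖ a (Matrix.diagonal e₁) M ∧ LatticeInLevel ϖ c' (Matrix.diagonal e₂) M)}.ncard : ℤ) : ℤ) : ℚ)) =
      8 * ∑ᶠ M₀ ∈ {M | M ∈ normalisedStableLattices T ∧ (LatticeInLevel ϖ a (Matrix.diagonal e₁) M ∧ LatticeInLevel ϖ c' (Matrix.diagonal e₂) M)},
        (kappaCount σ ϖ tv i M₀ : ℚ) * stabiliserWeight σ M₀ :=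
  cast_sum_signChar_mul_ncard_sep_eq_eight_mul_finsum_kappaCount hσ hvσ hϖ ϖu hϖu hσc hcv hc hdich hs hreg T hT tv i _
    fun z M => levels_mapGL_diagGLUnits_iff ϖ a c' e₁ e₂ z M

/-! ## §3  The composite: the κ-weighted four-frame levels census is `4·ω_i·` the labelled κ-Stage-B sum -/

omit [Valued K ℤᵐ⁰] in
/-- The sign table of ★ `F0P3cDyRamKappaSumSignClasses` (with its `ω(−1)` factors on slots `0, 1`) is `ω_i · χ⁰_i` for the κ-engine's `signChar` and `ω_i = (ω(−1), ω(−1), 1)_i`.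
[cite: LanglandsShelstad1987, §1.3] [cite: Rogawski1990, §4.9 p. 55] -/
theorem chi_eq_omega_mul_signChar (σ : K →+* K) (i : Fin 3) (e : Fin 3 → Bool) :
    (![(if e 1 then -1 else 1) * (if e 2 then -1 else 1) * normSign σ (-1),
       (if e 0 then -1 else 1) * (if e 2 then -1 else 1) * normSign σ (-1),
       (if e 0 then -1 else 1) * (if e 1 then -1 else 1)] : Fin 3 → ℤ) i =
      (![normSign σ (-1), normSign σ (-1), 1] : Fin 3 → ℤ) i *
        (![(if e 1 then -1 else 1) * (if e 2 then -1 else 1),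
           (if e 0 then -1 else 1) * (if e 2 then -1 else 1),
           (if e 0 then -1 else 1) * (if e 1 then -1 else 1)] : Fin 3 → ℤ) i := by
  fin_cases i <;> simp [mul_comm]

/-- **HEAD — THE κ-WEIGHTED FOUR-FRAME LEVELS CENSUS IS `4·ω_i·` THE LABELLED κ-STAGE-B SUM.**  Under the datum clauses (`σ` involutive isometric, `|ϖ| = exp(−1)`, even
valuations of the non-zero `σ`-fixed elements, finite residue field), with `c` a `σ`-fixed non-norm unit satisfying the index-two dichotomy, for a four-frame family `f`,
`T = diag(α, β, 1)` with `(α, β, 1)` pairwise-distinct units, `Γ_b = frameElt σ f b α β`, `D₁ = diag(α−1, β−1, 0)`, `D₂ = D₁²`, every vertex type `t`, levels `(a, c′)` and slot `i`: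
`Σ_b κ_i(b)·#{M : type t for Φ₃, Γ_b·M = M, (Γ_b−1)M ⊆ ϖ^aM, (Γ_b−1)²M ⊆ ϖ^{c′}M} = 4·ω_i·Σᶠ_{M₀ ∈ 𝓛₀(T), D₁M₀ ⊆ ϖ^aM₀ ∧ D₂M₀ ⊆ ϖ^{c′}M₀} kappaCount σ ϖ t i M₀ · stabiliserWeight σ M₀`
over `ℚ`, `ω_i = (ω(−1), ω(−1), 1)_i` (★ p858861 κ-side symmetrisation + §2).  The κ-LAWS of a level census ((K-ABS)∕(K-SGN) at shifted exponents) are thus labelled κ-Stage-B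
statements: a closed form for the right-hand `finsum`. [cite: Kottwitz1986BaseChangeUnits, §1 pp. 240–241] [cite: Rogawski1990, §4.9 Prop. 4.9.1 (a)(b) p. 55; §4.10 p. 58]
[cite: LanglandsShelstad1987, §1.3, §3] -/
theorem sum_kappaChar_mul_levelsCount_eq_four_mul_omega_mul_finsum_kappaCount_mul_stabiliserWeight [Finite 𝓀[K]] {σ : K →+* K} {ϖ : K}
    (hσ : ∀ x, σ (σ x) = x) (hvσ : ∀ a, Valued.v (σ a) = Valued.v a) (hϖ : Valued.v ϖ = WithZero.exp (-1 : ℤ)) (ϖu : Kˣ) (hϖu : (ϖu : K) = ϖ)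
    (heven : ∀ x : K, σ x = x → x ≠ 0 → ∃ n : ℤ, Valued.v x = WithZero.exp (2 * n))
    {c : K} (hσc : σ c = c) (hvc : Valued.v c = 1) (hcn : ¬ ∃ z : K, z * σ z = c)
    (hdich : ∀ x : K, σ x = x → x ≠ 0 → (∃ z : K, z * σ z = x) ∨ ∃ z : K, z * σ z = c * x)
    {f : Fin 4 → Fin 3 → (Fin 3 → K)} (hf : IsFourFrameFamily σ f) {α β : K}
    (hs : ∀ i : Fin 3, Valued.v ((![α, β, 1] : Fin 3 → K) i) = 1) (hreg : ∀ i j : Fin 3, i ≠ j → (![α, β, 1] : Fin 3 → K) i ≠ (![α, β, 1] : Fin 3 → K) j)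
    (T : GL (Fin 3) K) (hT : (T : Matrix (Fin 3) (Fin 3) K) = Matrix.diagonal ![α, β, 1])
    (Γ : Fin 4 → GL (Fin 3) K) (hΓ : ∀ b, (Γ b : Matrix (Fin 3) (Fin 3) K) = frameElt σ f b α β) (t a c' : ℕ) (i : Fin 3) :
    ((∑ b : Fin 4, kappaChar i b *
        ({M : Submodule 𝒪[K] (Fin 3 → K) | IsVertexLattice σ ϖ ((StdForm.antidiagonal 3).over K) t M ∧ mapGL (Γ b) M = M ∧
          (LatticeInLevel ϖ a ((Γ b : Matrix (Fin 3) (Fin 3) K) - 1) M ∧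
            LatticeInLevel ϖ c' (((Γ b : Matrix (Fin 3) (Fin 3) K) - 1) * ((Γ b : Matrix (Fin 3) (Fin 3) K) - 1)) M)}.ncard : ℤ) : ℤ) : ℚ) =
      4 * ((![normSign σ (-1), normSign σ (-1), 1] : Fin 3 → ℤ) i : ℚ) *
        ∑ᶠ M₀ ∈ {M | M ∈ normalisedStableLattices T ∧
            (LatticeInLevel ϖ a (Matrix.diagonal ![α - 1, β - 1, 0]) M ∧ LatticeInLevel ϖ c' (Matrix.diagonal ![(α - 1) * (α - 1), (β - 1) * (β - 1), 0]) M)},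
          (kappaCount σ ϖ t i M₀ : ℚ) * stabiliserWeight σ M₀ := by
  have h2 := two_mul_sum_kappaChar_mul_levelsCount_eq_sum_signClasses hσ hvσ hϖ heven hσc hvc hdich hf α β T hT Γ hΓ t a c' i
  have h8 := cast_sum_signChar_mul_ncard_levels_eq_eight_mul_finsum_kappaCount hσ hvσ hϖ ϖu hϖu hσc hvc hcn hdich hs hreg T hT t i a c'
    ![α - 1, β - 1, 0] ![(α - 1) * (α - 1), (β - 1) * (β - 1), 0]
  -- the two sign tables differ by the factor `ω_i`
  have hχ : (∑ s : Fin 3 → Bool,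
      (![(if s 1 then -1 else 1) * (if s 2 then -1 else 1) * normSign σ (-1),
         (if s 0 then -1 else 1) * (if s 2 then -1 else 1) * normSign σ (-1),
         (if s 0 then -1 else 1) * (if s 1 then -1 else 1)] : Fin 3 → ℤ) i *
      ({M : Submodule 𝒪[K] (Fin 3 → K) |
        IsVertexLattice σ ϖ (Matrix.diagonal fun j => if s j then c else (1 : K)) t M ∧ mapGL T M = M ∧
          (LatticeInLevel ϖ a (Matrix.diagonal ![α - 1, β - 1, 0]) M ∧
            LatticeInLevel ϖ c' (Matrix.diagonal ![(α - 1) * (α - 1), (β - 1) * (β - 1), 0]) M)}.ncard : ℤ)) =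
      (![normSign σ (-1), normSign σ (-1), 1] : Fin 3 → ℤ) i *
        ∑ s : Fin 3 → Bool,
          (![(if s 1 then -1 else 1) * (if s 2 then -1 else 1),
             (if s 0 then -1 else 1) * (if s 2 then -1 else 1),
             (if s 0 then -1 else 1) * (if s 1 then -1 else 1)] : Fin 3 → ℤ) i *
          ({M : Submodule 𝒪[K] (Fin 3 → K) |
            IsVertexLattice σ ϖ (Matrix.diagonal fun j => if s j then c else (1 : K)) t M ∧ mapGL T M = M ∧
              (LatticeInLevel ϖ a (Matrix.diagonal ![α - 1, β - 1, 0]) M ∧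
                LatticeInLevel ϖ c' (Matrix.diagonal ![(α - 1) * (α - 1), (β - 1) * (β - 1), 0]) M)}.ncard : ℤ) := by
    rw [Finset.mul_sum]
    refine Finset.sum_congr rfl fun s _ => ?_
    rw [chi_eq_omega_mul_signChar σ i s, mul_assoc]
  rw [hχ] at h2
  have h2q := congrArg (fun n : ℤ => (n : ℚ)) h2
  simp only [Int.cast_mul, Int.cast_ofNat] at h2q
  rw [h8] at h2q
  linear_combination (1 / 2 : ℚ) * h2q

end Summit.HodgeConjecture.HodgeConjecture.Cruxes.H413.F0P3cDyRamDiagonalKappaOrbitCountLabelled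

end
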